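import Mathlib
import Summits.NavierStokesRegularity.NavierStokesRegularity.Theorems.EulerZoomLiouvillePowerGaugeEulerLiouvilleDSSVorticityDecayFarField
import HarnessLib

/-!
# The DSS stratum of the crux `EulerZoomLiouville.PowerGaugeEulerLiouville` with vorticity in `L^q` for SMALL `q`
# (Chae–Tsai 2014 Thm 2.1 WITHOUT decay of the profile; route №10, item stmt-NavierStokesRegularity-19832)

Helper file (theorems only; `--supports stmt-NavierStokesRegularity-19832`). Seat ns-typeII-p3 (cell
ns-regularity-ideate §B, D-0081). Sequel of `…DSSVorticityDecayFarField.lean`. For a DSS member the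
scale-invariant gradient `|τ| ‖∇u(τ, y)‖` is log-periodic in `τ`, hence GLOBALLY bounded by
`δ₀ = l^{2+ρ}|τ⋆| sup_P ‖∇u‖` once `∇u` is bounded on one period `P`; likewise `|τ| |u| ≤ |y|/(2+ρ)` beyond
`|y| ≥ R₀|τ|^{1/(2+ρ)}` for `R₀` large (`farField_of_dss_of_bound`, via the propagation lemma
`farField_of_period`). Feeding this `δ₀` (no smallness!) to the vorticity-decay stratum and choosing the
exponent `q` SMALL makes `(1 − qδ₀(l^{2+ρ}−1)) · l^{3−q(2+ρ)} > 1` automatic. Result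
(`ae_eq_zero_of_gauge_of_dss_smallq`, binder form `powerGaugeEulerLiouville_dss_smallq`): «a classical DSS
member (factor `l > 1`) of the power-gauged class with bounded `u, ∇u` on compact time intervals and
`∫|curl u(τ)|^q dy` bounded on compact time intervals along a sequence of exponents `q ↓ 0` is trivial» —
every `ρ > 0`, no symmetry, NO decay hypothesis. This is Chae–Tsai, MRL 21 (2014) Thm 2.1
(`ω ∈ ∩_{0<q<r} L^q`, `V → 0` at infinity, harmonic Liouville) with the decay hypothesis removed (the class's
`A`-gauge Liouville closes); it CONTAINS the finite-measure-support stratum p516789 (bounded vorticity of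
finite-measure support lies in every `L^q`).

WHAT THIS IS NOT: not NS, not the crux E, not rung C2 whole — `∩_q L^q` forces faster-than-any-power
integrability of `|curl u|^q` near `q = 0` (e.g. Gaussian or compactly supported vorticity); algebraic tails
are the business of `…DSSVorticityDecayFarField.lean` (one `q < 3/(2+ρ)` + gradient decay), and the natural
tail is untouched by both. [folklore]
-/

noncomputable section

-- the summit and its single problem share the name `NavierStokesRegularity` (D-0017 nested layout)
set_option linter.dupNamespace false

open Set Function Filter Topology MeasureTheory Metric Module
open scoped NNReal ENNReal InnerProductSpace RealInnerProductSpace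

namespace Summit.NavierStokesRegularity.NavierStokesRegularity.Theorems.PowerGaugeEulerLiouville.VorticityDecay

open Literature.Analysis Literature.Analysis.FluidPDE
open Summit.NavierStokesRegularity.NavierStokesRegularity.Theorems.PowerGaugeEulerLiouville
open Summit.NavierStokesRegularity.NavierStokesRegularity.Theorems.PowerGaugeEulerLiouville.AxisymNoSwirl
open Summit.NavierStokesRegularity.NavierStokesRegularity.Theorems.PowerGaugeEulerLiouville.VorticitySupport

section SmallQ

variable {ρ l : ℝ} {u : ℝ → (EuclideanSpace ℝ (Fin 3)) → (EuclideanSpace ℝ (Fin 3))}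
  {p : ℝ → (EuclideanSpace ℝ (Fin 3)) → ℝ}

/-- **Propagation of scale-invariant far-field bounds from one period to all times** (log-periodicity
under the class scaling + the fundamental domain `exists_dss_conjugate`). [folklore] -/
theorem farField_of_period (hρ : 0 < ρ) (hns : IsClassicalNSSolutionOn (Iio 0) 0 0 u p) (hl : 1 < l)
    (hdss : ∀ τ : ℝ, τ < 0 → ∀ y, u τ y = (l ^ (1 + ρ)) • u ((l ^ (2 + ρ)) * τ) (l • y))
    {τs : ℝ} (hτs : τs < 0) {R₀ δ : ℝ}
    (hbase : ∀ τ ∈ Icc (l ^ (2 + ρ) * τs) τs, ∀ y : EuclideanSpace ℝ (Fin 3),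
      R₀ * (-τ) ^ (2 + ρ)⁻¹ ≤ ‖y‖ →
        (-τ) * ‖fderiv ℝ (u τ) y‖ ≤ δ ∧ (-τ) * ‖u τ y‖ ≤ (2 + ρ)⁻¹ * ‖y‖)
    {τ : ℝ} (hτ : τ < 0) (y : EuclideanSpace ℝ (Fin 3)) (hy : R₀ * (-τ) ^ (2 + ρ)⁻¹ ≤ ‖y‖) :
    (-τ) * ‖fderiv ℝ (u τ) y‖ ≤ δ ∧ (-τ) * ‖u τ y‖ ≤ (2 + ρ)⁻¹ * ‖y‖ := by
  have hρ2 : 0 < 2 + ρ := by linarith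
  have hl0 : 0 < l := zero_lt_one.trans hl
  set L : ℝ := l ^ (2 + ρ) with hLdef
  have hL1 : 1 < L := Real.one_lt_rpow hl (by linarith)
  have hL0 : 0 < L := zero_lt_one.trans hL1
  set n : ℝ := (2 + ρ)⁻¹ with hndef
  have hn0 : 0 < n := inv_pos.2 hρ2
  have hτ0 : 0 < -τ := by linarith
  obtain ⟨k, τ', hτ'P, hconj⟩ := exists_dss_conjugate hL1 hτs hτ
  have hτ'0 : τ' < 0 := hτ'P.2.trans_lt hτs
  obtain ⟨hpow1, hpow2⟩ := dss_power_identities (l := l) hρ2 hl0 k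
  have hlk : 0 < l ^ k := pow_pos hl0 k
  have hLk : 0 < L ^ k := pow_pos hL0 k
  rcases hconj with h | h
  · -- `τ = L^k τ'`: evaluate the iterated scaling at `(τ', l^{-k} y)`
    set y' : EuclideanSpace ℝ (Fin 3) := (l ^ k)⁻¹ • y with hy'
    have hyy' : l ^ k • y' = y := by rw [hy', smul_smul, mul_inv_cancel₀ hlk.ne', one_smul]
    have hτeq : L ^ k * τ' = τ := by rw [h]
    have hnorm : ‖y'‖ = (l ^ k)⁻¹ * ‖y‖ := by rw [hy', norm_smul, Real.norm_of_nonneg (inv_nonneg.2 hlk.le)]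
    have hneg : -τ = L ^ k * (-τ') := by rw [h]; ring
    have hrad : (-τ) ^ n = l ^ k * (-τ') ^ n := by
      rw [hneg, Real.mul_rpow hLk.le (by linarith), hpow1]
    have hy'far : R₀ * (-τ') ^ n ≤ ‖y'‖ := by
      rw [hnorm, le_inv_mul_iff₀ hlk]
      calc l ^ k * (R₀ * (-τ') ^ n) = R₀ * (-τ) ^ n := by rw [hrad]; ring
        _ ≤ ‖y‖ := hy
    obtain ⟨hg, hv⟩ := hbase τ' hτ'P y' hy'far
    have hiter := dss_iterate hl0 hdss k hτ'0 y'
    rw [hyy', hτeq] at hiter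
    have hd : Differentiable ℝ (u (L ^ k * τ')) := by
      rw [hτeq]; exact (hns.contDiff_velocity hτ).differentiable (by simp)
    have hD := fderiv_dss_iterate hl0 hdss k hτ'0 hd y'
    rw [hyy', hτeq] at hD
    refine ⟨?_, ?_⟩
    · have e : ‖fderiv ℝ (u τ') y'‖ = L ^ k * ‖fderiv ℝ (u τ) y‖ := by
        rw [hD, norm_smul, Real.norm_of_nonneg (by positivity), hpow2]
      calc (-τ) * ‖fderiv ℝ (u τ) y‖ = (-τ') * ‖fderiv ℝ (u τ') y'‖ := by rw [e, hneg]; ring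
        _ ≤ δ := hg
    · have hc : 0 < (l ^ (1 + ρ)) ^ k := pow_pos (Real.rpow_pos_of_pos hl0 _) k
      have e : ‖u τ' y'‖ = (l ^ (1 + ρ)) ^ k * ‖u τ y‖ := by
        rw [hiter, norm_smul, Real.norm_of_nonneg hc.le]
      have e2 : (-τ) * ‖u τ y‖ = l ^ k * ((-τ') * ‖u τ' y'‖) := by
        rw [e, hneg, ← hpow2]; field_simp
      rw [e2]
      calc l ^ k * ((-τ') * ‖u τ' y'‖) ≤ l ^ k * (n * ‖y'‖) := mul_le_mul_of_nonneg_left hv hlk.le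
        _ = n * ‖y‖ := by rw [hnorm]; field_simp
  · -- `τ' = L^k τ`: evaluate the iterated scaling at `(τ, y)`
    set y' : EuclideanSpace ℝ (Fin 3) := l ^ k • y with hy'
    have hnorm : ‖y'‖ = l ^ k * ‖y‖ := by rw [hy', norm_smul, Real.norm_of_nonneg hlk.le]
    have hneg : -τ' = L ^ k * (-τ) := by rw [h]; ring
    have hrad : (-τ') ^ n = l ^ k * (-τ) ^ n := by
      rw [hneg, Real.mul_rpow hLk.le hτ0.le, hpow1]
    have hy'far : R₀ * (-τ') ^ n ≤ ‖y'‖ := by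
      rw [hnorm, hrad]
      calc R₀ * (l ^ k * (-τ) ^ n) = l ^ k * (R₀ * (-τ) ^ n) := by ring
        _ ≤ l ^ k * ‖y‖ := mul_le_mul_of_nonneg_left hy hlk.le
    obtain ⟨hg, hv⟩ := hbase τ' hτ'P y' hy'far
    have hiter := dss_iterate hl0 hdss k hτ y
    rw [← h] at hiter
    have hd : Differentiable ℝ (u (L ^ k * τ)) := by
      rw [← h]; exact (hns.contDiff_velocity hτ'0).differentiable (by simp)
    have hD := fderiv_dss_iterate hl0 hdss k hτ hd y
    rw [← h] at hD
    refine ⟨?_, ?_⟩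
    · have e : ‖fderiv ℝ (u τ) y‖ = L ^ k * ‖fderiv ℝ (u τ') y'‖ := by
        rw [hD, hy', norm_smul, Real.norm_of_nonneg (by positivity), hpow2]
      calc (-τ) * ‖fderiv ℝ (u τ) y‖ = (-τ') * ‖fderiv ℝ (u τ') y'‖ := by rw [e, hneg]; ring
        _ ≤ δ := hg
    · have hc : 0 < (l ^ (1 + ρ)) ^ k := pow_pos (Real.rpow_pos_of_pos hl0 _) k
      have e : ‖u τ y‖ = (l ^ (1 + ρ)) ^ k * ‖u τ' y'‖ := by
        rw [hiter, hy', norm_smul, Real.norm_of_nonneg hc.le]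
      have e2 : l ^ k * ((-τ) * ‖u τ y‖) = (-τ') * ‖u τ' y'‖ := by
        rw [e, hneg, ← hpow2]; ring
      have h3 : l ^ k * ((-τ) * ‖u τ y‖) ≤ l ^ k * (n * ‖y‖) := by
        rw [e2]
        calc (-τ') * ‖u τ' y'‖ ≤ n * ‖y'‖ := hv
          _ = l ^ k * (n * ‖y‖) := by rw [hnorm]; ring
      exact le_of_mul_le_mul_left h3 hlk

/-- **Global scale-invariant bounds from boundedness on one period**: if `‖u‖, ‖∇u‖ ≤ B` on the period
`[l^{2+ρ}τ⋆, τ⋆]` of a classical DSS flow, then with `δ₀ = l^{2+ρ}|τ⋆|·max(B,0)` there is `R₀ > 0` such that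
`|τ| ‖∇u(τ,y)‖ ≤ δ₀` and `|τ| |u(τ,y)| ≤ |y|/(2+ρ)` for all `τ < 0`, `|y| ≥ R₀|τ|^{1/(2+ρ)}`. [folklore] -/
theorem farField_of_dss_of_bound (hρ : 0 < ρ) (hns : IsClassicalNSSolutionOn (Iio 0) 0 0 u p) (hl : 1 < l)
    (hdss : ∀ τ : ℝ, τ < 0 → ∀ y, u τ y = (l ^ (1 + ρ)) • u ((l ^ (2 + ρ)) * τ) (l • y))
    {τs : ℝ} (hτs : τs < 0) {B : ℝ}
    (hB : ∀ τ ∈ Icc (l ^ (2 + ρ) * τs) τs, ∀ y, ‖u τ y‖ ≤ B ∧ ‖fderiv ℝ (u τ) y‖ ≤ B) :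
    ∃ R₀ : ℝ, 0 < R₀ ∧ ∀ τ : ℝ, τ < 0 → ∀ y : EuclideanSpace ℝ (Fin 3), R₀ * (-τ) ^ (2 + ρ)⁻¹ ≤ ‖y‖ →
      (-τ) * ‖fderiv ℝ (u τ) y‖ ≤ l ^ (2 + ρ) * (-τs) * max B 0 ∧ (-τ) * ‖u τ y‖ ≤ (2 + ρ)⁻¹ * ‖y‖ := by
  have hρ2 : 0 < 2 + ρ := by linarith
  have hl0 : 0 < l := zero_lt_one.trans hl
  set L : ℝ := l ^ (2 + ρ) with hLdef
  have hL1 : 1 < L := Real.one_lt_rpow hl (by linarith)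
  set n : ℝ := (2 + ρ)⁻¹ with hndef
  have hn0 : 0 < n := inv_pos.2 hρ2
  have hτs' : 0 < -τs := by linarith
  set Bp : ℝ := max B 0 with hBp
  have hB0 : 0 ≤ Bp := le_max_right _ _
  have hsn : 0 < (-τs) ^ n := Real.rpow_pos_of_pos hτs' _
  set R₀ : ℝ := L * (-τs) * Bp * (2 + ρ) / (-τs) ^ n + 1 with hR₀def
  have hR₀2 : L * (-τs) * Bp * (2 + ρ) / (-τs) ^ n ≤ R₀ := by rw [hR₀def]; linarith
  have hR₀0 : 0 < R₀ := by rw [hR₀def]; positivity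
  refine ⟨R₀, hR₀0, fun τ hτ y hy => farField_of_period hρ hns hl hdss hτs (fun τ hτ y hy => ?_) hτ y hy⟩
  have hτ0 : 0 < -τ := by linarith [hτ.2]
  have hτL : -τ ≤ L * (-τs) := by linarith [hτ.1]
  have hmono : (-τs) ^ n ≤ (-τ) ^ n := Real.rpow_le_rpow hτs'.le (by linarith [hτ.2]) hn0.le
  have hy1 : R₀ * (-τs) ^ n ≤ ‖y‖ := (mul_le_mul_of_nonneg_left hmono hR₀0.le).trans hy
  refine ⟨?_, ?_⟩
  · exact mul_le_mul hτL (((hB τ hτ y).2).trans (le_max_left _ _)) (norm_nonneg _) (by positivity)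
  · have h1 : ‖u τ y‖ ≤ Bp := (hB τ hτ y).1.trans (le_max_left _ _)
    have h2 : L * (-τs) * Bp * (2 + ρ) ≤ R₀ * (-τs) ^ n := by rw [← div_le_iff₀ hsn]; exact hR₀2
    calc (-τ) * ‖u τ y‖ ≤ (L * (-τs)) * Bp := mul_le_mul hτL h1 (norm_nonneg _) (by positivity)
      _ = n * (L * (-τs) * Bp * (2 + ρ)) := by rw [hndef]; field_simp
      _ ≤ n * (R₀ * (-τs) ^ n) := mul_le_mul_of_nonneg_left h2 hn0.le
      _ ≤ n * ‖y‖ := mul_le_mul_of_nonneg_left hy1 hn0.le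

/-- **The DSS stratum with vorticity in `L^q` along a sequence `q ↓ 0`** (Chae–Tsai 2014 Thm 2.1 without
decay): a member of the power-gauged class (`ρ > 0`, crux hypotheses verbatim) that is classical on the
open slab, DSS with factor `l > 1`, with bounded `u, ∇u` on compact time intervals, and such that for every
`q₀ > 0` some exponent `q ∈ (0, q₀)` has `∫|curl u(τ)|^q` bounded on compact time intervals, vanishes a.e.
— every `ρ > 0`, no symmetry, no decay hypothesis. [folklore] -/
theorem ae_eq_zero_of_gauge_of_dss_smallq (hρ : 0 < ρ)
    {H : ℝ → (EuclideanSpace ℝ (Fin 3)) → (EuclideanSpace ℝ (Fin 3)) →L[ℝ] (EuclideanSpace ℝ (Fin 3))} {c : ℝ≥0}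
    (hH : HasWeakSpatialGradientOn (slab (EuclideanSpace ℝ (Fin 3)) (Iio 0) isOpen_Iio) u H)
    (hc : ∀ a : ℝ, 0 < a → ENNReal.ofReal (a ^ (2 * ρ)) * cknA a (0 : ℝ × (EuclideanSpace ℝ (Fin 3))) u +
        ENNReal.ofReal (a ^ ρ) * cknE a (0 : ℝ × (EuclideanSpace ℝ (Fin 3))) H +
        ENNReal.ofReal (a ^ (2 * ρ)) * cknD a (0 : ℝ × (EuclideanSpace ℝ (Fin 3))) p ≤ (c : ℝ≥0∞))
    (hns : IsClassicalNSSolutionOn (Iio 0) 0 0 u p) (hl : 1 < l)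
    (hdss : ∀ τ : ℝ, τ < 0 → ∀ y, u τ y = (l ^ (1 + ρ)) • u ((l ^ (2 + ρ)) * τ) (l • y))
    (hbdd : ∀ s t : ℝ, s < t → t < 0 → ∃ B : ℝ, ∀ τ ∈ Icc s t, ∀ y,
      ‖u τ y‖ ≤ B ∧ ‖fderiv ℝ (u τ) y‖ ≤ B)
    (hLq : ∀ q₀ : ℝ, 0 < q₀ → ∃ q : ℝ, 0 < q ∧ q < q₀ ∧ ∀ s t : ℝ, s < t → t < 0 → ∃ N : ℝ, ∀ τ ∈ Icc s t,
      Integrable (fun y => ‖curl (u τ) y‖ ^ q) ∧ ∫ y, ‖curl (u τ) y‖ ^ q ≤ N) :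
    uncurry u =ᵐ[volume.restrict (Iio (0 : ℝ) ×ˢ (univ : Set (EuclideanSpace ℝ (Fin 3))))] 0 := by
  have hρ2 : 0 < 2 + ρ := by linarith
  have hl0 : 0 < l := zero_lt_one.trans hl
  set L : ℝ := l ^ (2 + ρ) with hLdef
  have hL1 : 1 < L := Real.one_lt_rpow hl (by linarith)
  -- global scale-invariant bounds from the period `[-L, -1]`
  have hper : L * (-1) < -1 := by linarith
  obtain ⟨B, hB⟩ := hbdd (L * (-1)) (-1) hper (by norm_num)
  obtain ⟨R₀, hR₀, hfar⟩ := farField_of_dss_of_bound hρ hns hl hdss (by norm_num : (-1 : ℝ) < 0) hB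
  set δ₀ : ℝ := L * (-(-1 : ℝ)) * max B 0 with hδ₀
  have hδ₀0 : 0 ≤ δ₀ := by rw [hδ₀]; positivity
  -- choice of the exponent
  have hl2 : 1 < l ^ 2 := by nlinarith
  set κ₀ : ℝ := (1 - (l ^ 2)⁻¹) / 2 with hκ₀
  have hlinv : (l ^ 2)⁻¹ < 1 := inv_lt_one_of_one_lt₀ hl2
  have hκ₀0 : 0 < κ₀ := by rw [hκ₀]; linarith
  set q₀ : ℝ := min (2 + ρ)⁻¹ (κ₀ / (δ₀ * (L - 1) + 1)) with hq₀
  have hq₀0 : 0 < q₀ := lt_min (inv_pos.2 hρ2) (div_pos hκ₀0 (by nlinarith))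
  obtain ⟨q, hq, hqq₀, hLq'⟩ := hLq q₀ hq₀0
  have hq1 : q * (2 + ρ) ≤ 1 := by
    have : q ≤ (2 + ρ)⁻¹ := hqq₀.le.trans (min_le_left _ _)
    rw [← le_div_iff₀ hρ2, div_eq_inv_mul, mul_one] at *
    exact this
  have hθ : q * δ₀ * (L - 1) ≤ κ₀ := by
    have h1 : q ≤ κ₀ / (δ₀ * (L - 1) + 1) := hqq₀.le.trans (min_le_right _ _)
    have h2 : 0 ≤ δ₀ * (L - 1) := mul_nonneg hδ₀0 (by linarith)
    rw [le_div_iff₀ (by linarith)] at h1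
    nlinarith
  have hsmall : 1 < (1 - q * δ₀ * (L - 1)) * l ^ (3 - q * (2 + ρ)) := by
    have hA : 1 - κ₀ ≤ 1 - q * δ₀ * (L - 1) := by linarith
    have hB' : l ^ 2 ≤ l ^ (3 - q * (2 + ρ)) := by
      rw [← Real.rpow_natCast l 2]
      exact Real.rpow_le_rpow_of_exponent_le hl.le (by push_cast; linarith)
    have hκ₀1 : κ₀ < 1 := by
      rw [hκ₀]; have := inv_pos.2 (by positivity : (0 : ℝ) < l ^ 2); linarith
    have hprod : (1 - κ₀) * l ^ 2 ≤ (1 - q * δ₀ * (L - 1)) * l ^ (3 - q * (2 + ρ)) :=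
      mul_le_mul hA hB' (by positivity) (by linarith)
    have hval : 1 < (1 - κ₀) * l ^ 2 := by
      rw [hκ₀]
      have : (1 - (1 - (l ^ 2)⁻¹) / 2) * l ^ 2 = (l ^ 2 + 1) / 2 := by field_simp; ring
      rw [this]; linarith
    exact hval.trans_le hprod
  exact ae_eq_zero_of_gauge_of_dss_vorticityDecay hρ hH hc hns hl hdss hbdd hq hR₀ hδ₀0 hLq' hfar hsmall

/-- **Binder form**: the crux `PowerGaugeEulerLiouville` VERBATIM with the extra hypotheses «classical on the
open slab, DSS with factor `l > 1`, bounded `u`/`∇u` on compact time intervals, and `∫|curl u(τ)|^q` bounded on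
compact time intervals along a sequence of exponents `q ↓ 0`» — NO symmetry, NO decay (Chae–Tsai, MRL 21
(2014) Thm 2.1 for Seregin's class, the `A`-gauge Liouville replacing `V → 0`). [folklore] -/
theorem powerGaugeEulerLiouville_dss_smallq :
    ∀ ρ : ℝ, 0 < ρ → ∀ (u : ℝ → EuclideanSpace ℝ (Fin 3) → EuclideanSpace ℝ (Fin 3))
      (p : ℝ → EuclideanSpace ℝ (Fin 3) → ℝ)
      (H : ℝ → EuclideanSpace ℝ (Fin 3) → EuclideanSpace ℝ (Fin 3) →L[ℝ] EuclideanSpace ℝ (Fin 3)) (c : ℝ≥0)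
      (l : ℝ),
      IsSuitableWeakSolutionOn (slab (EuclideanSpace ℝ (Fin 3)) (Iio 0) isOpen_Iio) 0 0 u p →
      HasWeakSpatialGradientOn (slab (EuclideanSpace ℝ (Fin 3)) (Iio 0) isOpen_Iio) u H →
      (∀ a : ℝ, 0 < a → ENNReal.ofReal (a ^ (2 * ρ)) * cknA a (0 : ℝ × EuclideanSpace ℝ (Fin 3)) u +
        ENNReal.ofReal (a ^ ρ) * cknE a (0 : ℝ × EuclideanSpace ℝ (Fin 3)) H +
        ENNReal.ofReal (a ^ (2 * ρ)) * cknD a (0 : ℝ × EuclideanSpace ℝ (Fin 3)) p ≤ (c : ℝ≥0∞)) →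
      IsClassicalNSSolutionOn (Iio 0) 0 0 u p →
      1 < l →
      (∀ τ : ℝ, τ < 0 → ∀ y, u τ y = (l ^ (1 + ρ)) • u ((l ^ (2 + ρ)) * τ) (l • y)) →
      (∀ s t : ℝ, s < t → t < 0 → ∃ B : ℝ, ∀ τ ∈ Icc s t, ∀ y,
        ‖u τ y‖ ≤ B ∧ ‖fderiv ℝ (u τ) y‖ ≤ B) →
      (∀ q₀ : ℝ, 0 < q₀ → ∃ q : ℝ, 0 < q ∧ q < q₀ ∧ ∀ s t : ℝ, s < t → t < 0 → ∃ N : ℝ, ∀ τ ∈ Icc s t,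
        Integrable (fun y => ‖curl (u τ) y‖ ^ q) ∧ ∫ y, ‖curl (u τ) y‖ ^ q ≤ N) →
      Function.uncurry u =ᵐ[volume.restrict (Iio (0 : ℝ) ×ˢ (univ : Set (EuclideanSpace ℝ (Fin 3))))] 0 :=
  fun _ hρ _ _ _ _ _ _ hH hc hns hl hdss hbdd hLq =>
    ae_eq_zero_of_gauge_of_dss_smallq hρ hH hc hns hl hdss hbdd hLq

end SmallQ

end Summit.NavierStokesRegularity.NavierStokesRegularity.Theorems.PowerGaugeEulerLiouville.VorticityDecay

end
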